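import Literature.AlgebraicGeometry.Resolution.RegularLocalRingsJacobian
import Literature.AlgebraicGeometry.Resolution.NodalBlowupStrictTransformPrimes
import Summits.ResolutionOfSingularities.ResolutionOfSingularities.Theorems.EquisingularLiftCampaignW45bAvoidBadPoint
import HarnessLib

/-!
# [OURS · L1 W4.5(b)] The chart `R[(a,b)/a] ≅ R[X]/(aX − b)` of the blow-up of a two-generated ideal, and its local rings

Crux chain w45b, working crux EL♮ = `Theses.EquisingularLift.EquisingularLiftNat` (stmt-ResolutionOfSingularities-20038), research
stub `stub_elnat_three`; engine for helper L2 «UNIQUE BAD POINT» of CRUX-PLAN v1.1 §3.4 (res-L1-w45b-plan-1), companion of AVOID-L1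
(`…AvoidBadPoint.lean`). OURS; NOT a statement of any manuscript; AI-written, weaker than expert review.
`--supports stmt-ResolutionOfSingularities-20038 --as helper`.

For a domain `R`, `a ≠ 0` and `b` with `a ∣ b x ⇒ a ∣ x` (e.g. `a` prime not dividing `b`, or `b` prime not dividing `a`), the affine
blowup algebra `B = R[I/a] ⊆ R[1/a]` of `I = (a, b)` at `a` (`Literature…blowupAlgebra`) is the HYPERSURFACE `R[X]/(aX − b)`:

* `aeval_gen_surjective_of_eq` — `B = R[b/a]` for any ideal `I = (a, b)` (handles both orderings of the pair);
* `ker_aeval_gen_eq_span` — the kernel of `R[X] → B`, `X ↦ b/a`, is `(aX − b)` (test map to `Frac R` + the tree's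
  `Polynomial.mem_span_C_mul_X_sub_C_of_aeval_div_eq_zero`);
* `exists_ringEquiv_quotient_span` — `R[X]/(aX − b) ≃ B`, `X ↦ b/a`;
* `isRegularLocalRing_localization_quotient_iff` — localisation commutes with quotients: `(A/I)_𝔭 ≅ A_𝔮/IA_𝔮` (the tree's
  `isRegularLocalRing_localization_quotient_map`, both directions);
* **`isRegularLocalRing_localization_iff_chart`** — for a prime `𝔔` of `B` with preimage `Q ⊆ R[X]`: `B_𝔔` is regular iff
  `R[X]_Q/(aX − b)` is regular. This turns the regularity of the points of `Bl_{(a,b)}` into the hypersurface criterion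
  «`aX − b ∉ 𝔑_Q²`» in the regular local rings `R[X]_Q` (Matsumura 14.2), used in `…UniqueBadPoint.lean`.

References: Q. Liu, *Algebraic Geometry and Arithmetic Curves* (2002), Lemma 8.1.2 / 8.1.4 (charts of blow-ups of regular
sequences); H. Matsumura, *Commutative Ring Theory*, Thm. 14.2 — context; res-L1-w45b-plan-1 CRUX-PLAN v1.1 §3.4 L2 (OURS).
-/

noncomputable section

set_option linter.dupNamespace false -- mandated namespace `Summit.<Summit>.<Problem>` of this single-conjunct summit

open IsLocalRing IsLocalization Polynomial
open Literature.AlgebraicGeometry.Resolution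

namespace Summit.ResolutionOfSingularities.ResolutionOfSingularities.Cruxes.EquisingularLiftNat.Sections

universe u

section Presentation

variable {R : Type u} [CommRing R] {a b : R}

/-- `B = R[b/a]` for every ideal `I` EQUAL to `(a, b)` — the generating pair may be listed in either order
(`Ideal.span {a, b} = Ideal.span {b, a}`), so both charts of `Bl_{(e,w)}` are covered. [folklore] -/
theorem aeval_gen_surjective_of_eq (I : Ideal R) (hI : I = Ideal.span {a, b}) (hb : b ∈ I) :
    Function.Surjective (Polynomial.aeval (R := R) (blowupAlgebra.gen I a b hb)) := by
  subst hI
  exact aeval_gen_surjective a b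

/-- `aX − b ↦ 0` under `X ↦ b/a`. [folklore] -/
theorem aeval_gen_C_mul_X_sub_C (I : Ideal R) (hb : b ∈ I) :
    Polynomial.aeval (blowupAlgebra.gen I a b hb) (C a * X - C b) = 0 := by
  rw [map_sub, map_mul, Polynomial.aeval_C, Polynomial.aeval_X, Polynomial.aeval_C,
    blowupAlgebra.algebraMap_mul_gen, sub_self]

/-- **The kernel of `R[X] → R[I/a]`, `X ↦ b/a`, is `(aX − b)`** for a domain `R`, `a ≠ 0` and `a ∣ b x ⇒ a ∣ x`: a polynomial
relation `p(b/a) = 0` holds in `Frac R` (test map `R[I/a] → Frac R`), where the tree's kernel lemma applies. [folklore] -/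
theorem ker_aeval_gen_eq_span [IsDomain R] (I : Ideal R) (hb : b ∈ I) (ha : a ≠ 0)
    (hab : ∀ x : R, a ∣ b * x → a ∣ x) :
    RingHom.ker (Polynomial.aeval (R := R) (blowupAlgebra.gen I a b hb)) = Ideal.span {C a * X - C b} := by
  apply le_antisymm
  · intro p hp
    rw [RingHom.mem_ker] at hp
    -- test map to the fraction field
    let K := FractionRing R
    have hne : algebraMap R K a ≠ 0 := fun h =>
      ha (IsFractionRing.injective R K (by rw [h, map_zero]))
    have haK : IsUnit (algebraMap R K a) := isUnit_iff_ne_zero.mpr hne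
    let ψ : blowupAlgebra I a →+* K := blowupAlgebra.testHom I a (algebraMap R K) haK
    have hψC : ψ.comp (algebraMap R (blowupAlgebra I a)) = algebraMap R K :=
      RingHom.ext fun r => blowupAlgebra.testHom_algebraMap I a _ haK r
    have hψt : ψ (blowupAlgebra.gen I a b hb) = algebraMap R K b / algebraMap R K a := by
      rw [eq_div_iff hne]
      exact blowupAlgebra.testHom_gen_mul I a _ haK b hb
    have h0 : Polynomial.aeval (algebraMap R K b / algebraMap R K a) p = 0 := by
      have h := congrArg ψ hp
      rw [map_zero, Polynomial.aeval_def, Polynomial.hom_eval₂, hψC, hψt] at h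
      rwa [Polynomial.aeval_def]
    exact Polynomial.mem_span_C_mul_X_sub_C_of_aeval_div_eq_zero (K := K) ha hab h0
  · rw [Ideal.span_le, Set.singleton_subset_iff]
    exact aeval_gen_C_mul_X_sub_C I hb

/-- **`R[X]/(aX − b) ≅ R[I/a]`, `X ↦ b/a`**, for `I = (a, b)` in a domain with `a ≠ 0`, `a ∣ b x ⇒ a ∣ x`. [folklore] -/
theorem exists_ringEquiv_quotient_span [IsDomain R] (I : Ideal R) (hI : I = Ideal.span {a, b}) (hb : b ∈ I)
    (ha : a ≠ 0) (hab : ∀ x : R, a ∣ b * x → a ∣ x) :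
    ∃ φ : (R[X] ⧸ Ideal.span {C a * X - C b}) ≃+* blowupAlgebra I a,
      ∀ p : R[X], φ (Ideal.Quotient.mk _ p) = Polynomial.aeval (blowupAlgebra.gen I a b hb) p := by
  have hsurj := aeval_gen_surjective_of_eq I hI hb
  have hker := ker_aeval_gen_eq_span I hb ha hab
  refine ⟨(Ideal.quotEquivOfEq hker.symm).trans (Ideal.quotientKerAlgEquivOfSurjective hsurj).toRingEquiv, fun p => ?_⟩
  rw [RingEquiv.trans_apply, Ideal.quotEquivOfEq_mk]
  exact Ideal.quotientKerAlgEquivOfSurjective_mk hsurj p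

end Presentation

/-! ## Localisation commutes with quotients (both directions) -/

/-- `(A/I)_𝔭 ≅ A_𝔮/IA_𝔮` for `𝔮` the preimage of `𝔭`: regularity of one is regularity of the other (the tree's
`isRegularLocalRing_localization_quotient_map`, made an `iff`). [folklore] -/
theorem isRegularLocalRing_localization_quotient_iff {A : Type u} [CommRing A] (I : Ideal A)
    (P : Ideal (A ⧸ I)) [P.IsPrime] :
    IsRegularLocalRing (Localization.AtPrime P) ↔
      IsRegularLocalRing (Localization.AtPrime (P.comap (Ideal.Quotient.mk I)) ⧸
        I.map (algebraMap A (Localization.AtPrime (P.comap (Ideal.Quotient.mk I))))) := by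
  let Q := P.comap (Ideal.Quotient.mk I)
  haveI hQ : Q.IsPrime := Ideal.comap_isPrime _ P
  have hsub : Algebra.algebraMapSubmonoid (A ⧸ I) Q.primeCompl = P.primeCompl := by
    ext x
    constructor
    · rintro ⟨c, hc, rfl⟩
      exact hc
    · intro hx
      obtain ⟨c, rfl⟩ := Ideal.Quotient.mk_surjective x
      exact ⟨c, hx, rfl⟩
  haveI : IsLocalization.AtPrime
      (Localization.AtPrime Q ⧸ I.map (algebraMap A (Localization.AtPrime Q))) P := by
    change IsLocalization P.primeCompl _
    rw [← hsub]
    infer_instance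
  let e : Localization.AtPrime P ≃ₐ[A ⧸ I]
      Localization.AtPrime Q ⧸ I.map (algebraMap A (Localization.AtPrime Q)) :=
    IsLocalization.algEquiv P.primeCompl _ _
  exact ⟨fun _ => IsRegularLocalRing.of_ringEquiv e.toRingEquiv,
    fun _ => IsRegularLocalRing.of_ringEquiv e.toRingEquiv.symm⟩

/-! ## Local rings of the chart -/

/-- **The points of the chart are hypersurface points**: for a prime `𝔔` of `B = R[I/a]` (`I = (a, b)`, `R` a domain, `a ≠ 0`,
`a ∣ b x ⇒ a ∣ x`) with preimage `Q` in `R[X]` under `X ↦ b/a`, the local ring `B_𝔔` is regular iff `R[X]_Q/(aX − b)` is.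
[folklore] -/
theorem isRegularLocalRing_localization_iff_chart {R : Type u} [CommRing R] [IsDomain R] {a b : R} (I : Ideal R)
    (hI : I = Ideal.span {a, b}) (hb : b ∈ I) (ha : a ≠ 0) (hab : ∀ x : R, a ∣ b * x → a ∣ x)
    (𝔔 : Ideal (blowupAlgebra I a)) [𝔔.IsPrime] (Q : Ideal R[X]) [Q.IsPrime]
    (hQ : Q = Ideal.comap (Polynomial.aeval (R := R) (blowupAlgebra.gen I a b hb)) 𝔔) :
    IsRegularLocalRing (Localization.AtPrime 𝔔) ↔
      IsRegularLocalRing (Localization.AtPrime Q ⧸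
        Ideal.span {algebraMap R[X] (Localization.AtPrime Q) (C a * X - C b)}) := by
  obtain ⟨φ, hφ⟩ := exists_ringEquiv_quotient_span I hI hb ha hab
  have hPQ : Q = (𝔔.comap φ).comap
      (Ideal.Quotient.mk (Ideal.span {C a * X - C b})) := by
    rw [hQ]
    ext p
    simp only [Ideal.mem_comap, hφ]
  subst hPQ
  haveI hP : (𝔔.comap φ).IsPrime :=
    Ideal.comap_isPrime _ 𝔔
  -- `B_𝔔 ≅ (R[X]/(aX − b))_P`, `P = φ⁻¹ 𝔔`
  have e₁ : Localization.AtPrime (𝔔.comap φ) ≃+*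
      Localization.AtPrime 𝔔 :=
    IsLocalization.ringEquivOfRingEquiv _ (Localization.AtPrime 𝔔) φ (φ.map_primeCompl_comap_eq 𝔔)
  have h1 : IsRegularLocalRing (Localization.AtPrime 𝔔) ↔ IsRegularLocalRing
      (Localization.AtPrime (𝔔.comap φ)) :=
    ⟨fun h => @IsRegularLocalRing.of_ringEquiv _ _ h _ _ e₁.symm, fun h => @IsRegularLocalRing.of_ringEquiv _ _ h _ _ e₁⟩
  rw [h1, isRegularLocalRing_localization_quotient_iff]
  -- `(aX − b) · R[X]_Q = (aX − b)` as ideals of the localisation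
  have hmap : (Ideal.span {C a * X - C b}).map (algebraMap R[X] (Localization.AtPrime
      ((𝔔.comap φ).comap
        (Ideal.Quotient.mk (Ideal.span {C a * X - C b}))))) =
      Ideal.span {algebraMap R[X] _ (C a * X - C b)} := by
    rw [Ideal.map_span, Set.image_singleton]
  exact ⟨fun h => @IsRegularLocalRing.of_ringEquiv _ _ h _ _ (Ideal.quotEquivOfEq hmap),
    fun h => @IsRegularLocalRing.of_ringEquiv _ _ h _ _ (Ideal.quotEquivOfEq hmap.symm)⟩

end Summit.ResolutionOfSingularities.ResolutionOfSingularities.Cruxes.EquisingularLiftNat.Sections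

end
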